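import Summits.BirchSwinnertonDyer.Rank1Residual.X11b.AnticyclotomicInfinitePlaces
import Summits.BirchSwinnertonDyer.Rank1Residual.X11b.BDPRouteControlUpper
import HarnessLib

/-!
# Class X11b, route p2 ("BDP + converse-theorem engine + Kolyvagin"): the COUNTING snake lemma
# `#Sel_𝔭^Σ(K_∞, E[p^∞])^Γ ≤ #Sel_𝔭^Σ(K, E[p^∞]) · ∏_{v ∈ T} #ker r_v` on the constructed objects
# (cell `b2b-bsdres`, sub-cell `multr1-p2`, gen 13)

HONEST FRAMING (verbatim, cell `b2b-bsdres`): the goal of the cell is to DELETE the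
COMBINATION-SHAPED residual classes for ALL analytic-rank `≤ 1` curves over `ℚ` — "full BSD
formula for every rank `≤ 1` curve in class `C`" assembled STRICTLY from published theorems — so
that the rank-`≤ 1` remainder becomes exactly the CONSTRUCTION-SHAPED classes, which are TYPED
(missing-input Props), NOT attempted; this is not "finishing BSD". Research route `p2` for class
X11b; no claim beyond the stated class; nothing booked; X11b stays CONSTRUCTION-SHAPED. Definitions
with bodies and theorems only; no named fact; no `sorry`. Continues `BDPRouteControlUpper.lean`
(gen 12) and the sibling's `AnticyclotomicControlCokernel` / `AnticyclotomicInfinitePlaces`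
(multr1-p1 gen 10: `s` surjective when EVERY away condition descends). Greenberg (LNM 1716 §3) and
JSW (§3.3) prove control through `0 → ker s → ker h → ker g → coker s → coker h = 0`,
`ker g ⊆ ⊕_v ker r_v`; route p2 needs the COUNT with non-trivial local kernels (the `c_w^{(p)}`,
`w ∣ N⁺`, of Cas18 Thm. 2.3, Lemma 3.3). Here: `localKer H M v = ker (H¹(⊤ ⊓ D_v, M) → H¹(H ⊓ D_v, M))`;
`selmerAcPreimage = A = res⁻¹(Sel_𝔭^Σ(K_∞, E[p^∞]))` (Greenberg's `A_0`); `locAtFinset`;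
**`finite_endInvariants_and_natCard_le_of_localKer`**: for `E` over a totally complex `K`, `κ` with
generator `γ`, `𝔭`, `Σ`, `T` finite (`v ∤ p`, `v ∉ Σ`): if `E(K̄)[p^∞]^{D_𝔭 ⊓ ker κ} = 0`, the away
conditions descend outside `Σ ∪ T`, `Sel_𝔭^Σ(K, E[p^∞])` and the `ker r_v` (`v ∈ T`) are finite,
then `Sel^γ` is finite and `#Sel^γ ≤ #Sel_𝔭^Σ(K, E[p^∞]) · ∏_{v∈T} #ker r_v` (`res : A ↠ Sel^γ` by
Lemma 3.2, tree-proved; `ψ|_A : A → ∏_{v∈T} H¹(K_v, ·)` has kernel `Sel_𝔭^Σ(K)` and image in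
`∏ ker r_v`; Lemma 3.1 is NOT used); **`controlUpperOnTreeAt_of_localKer_bounds`**: p2's input
(CTL≤)ᵗ at a datum (`Σ = ∅`) from (a) `E(K̄)[p^∞]^{D_𝔭 ⊓ ker κ} = 0` [⇐ (iv), sibling], (b) away
descent outside `T` [Lemma 3.3 good `v` + split places, sibling], (c) `#ker r_v ≤ p^{b_v}` on `T`
[Lemma 3.3 bad `v`: `c_v^{(p)}`], (d) `#Sel_𝔭(K, E[p^∞]) ≤ p^a` [JSW Prop. 3.2.1 / Cas18 (3.2.1) +
local index at `𝔭`; reciprocity half of Poitou–Tate], `a + ∑ b_v ≤` the exponent of Cas18 Thm. 2.3.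
Only (c), (d) are not tree theorems. CONDITIONAL; nothing booked; reach and labels unchanged.

References: [GreenbergLNM1716] §3 pp. 85–87, 90; [JetchevSkinnerWan2017] §3.3, Prop. 3.2.1, Thm.
3.3.1 (arXiv:1512.06894 pp. 10–14); [Castella2018] Def. 2.2, Thm. 2.3 (arXiv:1704.06608 pp. 5–6).
-/

noncomputable section

open scoped Classical

open NumberField IsDedekindDomain Field
open Literature.NumberTheory.EllipticCurves Literature.NumberTheory.EllipticCurves.GreenbergSelmer
open Literature.NumberTheory.GaloisRepresentations

universe u

namespace Summit.BirchSwinnertonDyer.Rank1Residual.X11b.AcSelmer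

/-! ## The local kernel `ker r_v = ker (H¹(K_v, M) → H¹(K_{∞,w}, M))` -/

section LocalKer

variable {K : Type u} [Field K] [NumberField K]
variable (H : Subgroup (absoluteGaloisGroup K)) (M : Type u) [AddCommGroup M]
  [DistribMulAction (absoluteGaloisGroup K) M] [TopologicalSpace M] [DiscreteTopology M]

/-- **Greenberg's local kernel `ker r_v`** at a finite place `v` for `L = K̄^H` (intended `H = ker κ`,
`L = K_∞`): `ker (H¹(⊤ ⊓ D_v, M) → H¹(H ⊓ D_v, M))`, i.e. `ker (H¹(K_v, M) → H¹(L_w, M))` at the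
chosen place `w ∣ v` (`D_v = GreenbergSelmer.decomp v`); `≅ H¹(L_w/K_v, M(L_w))` by
inflation–restriction (p. 87; not needed here). [cite: GreenbergLNM1716, §3 pp. 85–87 (`r_v`, Lemma 3.3)] -/
def localKer (v : HeightOneSpectrum (𝓞 K)) :
    AddSubgroup (subgroupH1 ((⊤ : Subgroup (absoluteGaloisGroup K)) ⊓ decomp v) M) :=
  (resOfLe M (inf_le_inf_right (decomp v) (le_top : H ≤ ⊤))).ker

variable {H M}

/-- **`loc_v c ∈ ker r_v ↔ res_{K→L} c` is locally trivial at `w`** (`c ∈ H¹(⊤, M) = H¹(K, M)`): both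
say `res_{H ⊓ D_v} c = 0` (restriction along `⊤ → ⊤ ⊓ D_v → H ⊓ D_v` and `⊤ → H → H ⊓ D_v`).
[cite: GreenbergLNM1716, §3 p. 85 (the localisation maps commute with restriction)] -/
theorem resOfLe_mem_localKer_iff (v : HeightOneSpectrum (𝓞 K))
    (c : subgroupH1 (⊤ : Subgroup (absoluteGaloisGroup K)) M) :
    resOfLe M (inf_le_left : (⊤ : Subgroup (absoluteGaloisGroup K)) ⊓ decomp v ≤ ⊤) c ∈
        localKer H M v ↔
      resOfLe M (le_top : H ≤ ⊤) c ∈ awayKer H M v := by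
  rw [localKer, awayKer, AddMonoidHom.mem_ker, AddMonoidHom.mem_ker, ← AddMonoidHom.comp_apply,
    ← AddMonoidHom.comp_apply, resOfLe_comp_holds, resOfLe_comp_holds]

/-- `c ∈ awayKer ⊤ M v` iff the localisation `res_{⊤ ⊓ D_v} c` vanishes (unfolding). [folklore] -/
theorem mem_awayKer_top_iff (v : HeightOneSpectrum (𝓞 K))
    (c : subgroupH1 (⊤ : Subgroup (absoluteGaloisGroup K)) M) :
    c ∈ awayKer ⊤ M v ↔
      resOfLe M (inf_le_left : (⊤ : Subgroup (absoluteGaloisGroup K)) ⊓ decomp v ≤ ⊤) c = 0 :=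
  AddMonoidHom.mem_ker

end LocalKer

/-! ## The preimage `A = res⁻¹(Sel_𝔭^Σ(K_∞, E[p^∞]))` and the localisation at a finite set of places -/

section Preimage

variable {K : Type} [Field K] [NumberField K] -- `K : Type` as in `AnticyclotomicInfinitePlaces`
variable (W : WeierstrassCurve K) (p : ℕ) [Fact p.Prime] (κ : ZpExtension K p)
  (𝔭 : HeightOneSpectrum (𝓞 K)) (S : Set (HeightOneSpectrum (𝓞 K)))

/-- **`A = res⁻¹(Sel_𝔭^Σ(K_∞, E[p^∞])) ⊆ H¹(⊤, E[p^∞]) = H¹(K, E[p^∞])`** (Greenberg's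
`A_0 = h_0⁻¹(Sel_∞)`; cf. `WeierstrassCurve.selmerInftyPreimage` for the classical Selmer group);
contains `Sel_𝔭^Σ(K, E[p^∞])`. [cite: GreenbergLNM1716, §3 p. 85 and p. 90 (`ker g_n`)] -/
def selmerAcPreimage : AddSubgroup (W.subgroupH1 p (⊤ : Subgroup (absoluteGaloisGroup K))) :=
  (selmerAc W p κ 𝔭 S).comap (W.resOfLe p (le_top : κ.kerSubgroup ≤ ⊤))

variable {W p κ 𝔭 S}

/-- Membership in `A`: `res_{K→K_∞} c ∈ Sel_𝔭^Σ(K_∞, E[p^∞])`. [folklore] -/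
theorem mem_selmerAcPreimage_iff (c : W.subgroupH1 p (⊤ : Subgroup (absoluteGaloisGroup K))) :
    c ∈ selmerAcPreimage W p κ 𝔭 S ↔
      W.resOfLe p (le_top : κ.kerSubgroup ≤ ⊤) c ∈ selmerAc W p κ 𝔭 S :=
  AddSubgroup.mem_comap

/-- `Sel_𝔭^Σ(K, E[p^∞]) ≤ A` (`resOfLe_mem_selmerAc`). [cite: GreenbergLNM1716, §3 p. 85] -/
theorem selmerAcBase_le_selmerAcPreimage :
    selmerAcBase W p 𝔭 S ≤ selmerAcPreimage W p κ 𝔭 S :=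
  fun _ hc ↦ (mem_selmerAcPreimage_iff _).mpr (resOfLe_mem_selmerAc hc)

omit [Fact p.Prime] in
/-- A class of `Sel_𝔭^Σ(K, E[p^∞])` is locally trivial at every finite `v ∤ p`, `v ∉ Σ` (the away
condition over `K`, `σ = 1`). [cite: Castella2018, Def. 2.2 (arXiv:1704.06608 p. 5)] -/
theorem mem_awayKer_of_mem_selmerAcBase {c : W.subgroupH1 p (⊤ : Subgroup (absoluteGaloisGroup K))}
    (hc : c ∈ selmerAcBase W p 𝔭 S) {v : HeightOneSpectrum (𝓞 K)}
    (hv : ((p : ℕ) : 𝓞 K) ∉ v.asIdeal) (hvS : v ∉ S) :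
    c ∈ awayKer ⊤ (W.geomPrimaryTorsion p) v := by
  have h1 := ((mem_selmerOver_iff _).mp hc).1 v hv hvS 1
  rwa [conjH1_of_mem_holds ⊤ (W.geomPrimaryTorsion p) (Subgroup.mem_top _),
    AddMonoidHom.id_apply] at h1

/-- A class of `A` localises into `ker r_v` at every finite `v ∤ p`, `v ∉ Σ` (its restriction to
`K_∞` is locally trivial at `w`). [cite: GreenbergLNM1716, §3 p. 90 ("`ker g_n` … `⊕ ker r_v`")] -/
theorem resOfLe_mem_localKer_of_mem_selmerAcPreimage
    {c : W.subgroupH1 p (⊤ : Subgroup (absoluteGaloisGroup K))}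
    (hc : c ∈ selmerAcPreimage W p κ 𝔭 S) {v : HeightOneSpectrum (𝓞 K)}
    (hv : ((p : ℕ) : 𝓞 K) ∉ v.asIdeal) (hvS : v ∉ S) :
    resOfLe (W.geomPrimaryTorsion p)
        (inf_le_left : (⊤ : Subgroup (absoluteGaloisGroup K)) ⊓ decomp v ≤ ⊤) c ∈
      localKer κ.kerSubgroup (W.geomPrimaryTorsion p) v := by
  rw [resOfLe_mem_localKer_iff]
  have h1 := ((mem_selmerOver_iff _).mp ((mem_selmerAcPreimage_iff c).mp hc)).1 v hv hvS 1
  rwa [conjH1_one_holds, AddMonoidHom.id_apply] at h1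

variable (W p) in
/-- **Localisation at a finite set `T` of finite places**: `H¹(K, E[p^∞]) → ∏_{v ∈ T} H¹(K_v, E[p^∞])`,
`c ↦ (res_{⊤ ⊓ D_v} c)_{v ∈ T}`. [cite: GreenbergLNM1716, §3 p. 85 (`P_E`, `G_E`)] -/
def locAtFinset (T : Finset (HeightOneSpectrum (𝓞 K))) :
    W.subgroupH1 p (⊤ : Subgroup (absoluteGaloisGroup K)) →+
      Π v : T, subgroupH1 ((⊤ : Subgroup (absoluteGaloisGroup K)) ⊓
        decomp (v : HeightOneSpectrum (𝓞 K))) (W.geomPrimaryTorsion p) :=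
  AddMonoidHom.pi fun v : T ↦
    resOfLe (W.geomPrimaryTorsion p)
      (inf_le_left : (⊤ : Subgroup (absoluteGaloisGroup K)) ⊓
        decomp (v : HeightOneSpectrum (𝓞 K)) ≤ ⊤)

omit [Fact p.Prime] in
/-- Unfolding `locAtFinset`. [folklore] -/
@[simp]
theorem locAtFinset_apply (T : Finset (HeightOneSpectrum (𝓞 K)))
    (c : W.subgroupH1 p (⊤ : Subgroup (absoluteGaloisGroup K))) (v : T) :
    locAtFinset W p T c v =
      resOfLe (W.geomPrimaryTorsion p)
        (inf_le_left : (⊤ : Subgroup (absoluteGaloisGroup K)) ⊓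
          decomp (v : HeightOneSpectrum (𝓞 K)) ≤ ⊤) c :=
  rfl

/-- **`ker (ψ|_A) = Sel_𝔭^Σ(K, E[p^∞])`**: for totally complex `K`, `E(K̄)[p^∞]^{D_𝔭 ⊓ ker κ} = 0`
(the strict condition descends) and away descent outside `Σ ∪ T`, a class `c ∈ A` lies in
`Sel_𝔭^Σ(K, E[p^∞])` iff its localisations at `T` vanish. [cite: GreenbergLNM1716, §3 pp. 85–86, 90] -/
theorem mem_selmerAcBase_iff_locAtFinset_eq_zero [IsTotallyComplex K]
    (h0 : FixedPoints.addSubgroup ↥(decomp 𝔭 ⊓ κ.kerSubgroup) (W.geomPrimaryTorsion p) = ⊥)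
    {T : Finset (HeightOneSpectrum (𝓞 K))}
    (hTp : ∀ v ∈ T, ((p : ℕ) : 𝓞 K) ∉ v.asIdeal) (hTS : ∀ v ∈ T, v ∉ S)
    (hS : ∀ c : W.subgroupH1 p (⊤ : Subgroup (absoluteGaloisGroup K)),
      W.resOfLe p (le_top : κ.kerSubgroup ≤ ⊤) c ∈ selmerAc W p κ 𝔭 S →
        ∀ v : HeightOneSpectrum (𝓞 K), ((p : ℕ) : 𝓞 K) ∉ v.asIdeal → v ∉ S → v ∉ T →
          c ∈ awayKer ⊤ (W.geomPrimaryTorsion p) v)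
    {c : W.subgroupH1 p (⊤ : Subgroup (absoluteGaloisGroup K))}
    (hc : c ∈ selmerAcPreimage W p κ 𝔭 S) :
    c ∈ selmerAcBase W p 𝔭 S ↔ locAtFinset W p T c = 0 := by
  have hcSel : W.resOfLe p (le_top : κ.kerSubgroup ≤ ⊤) c ∈ selmerAc W p κ 𝔭 S :=
    (mem_selmerAcPreimage_iff c).mp hc
  constructor
  · intro h
    funext v
    rw [locAtFinset_apply, Pi.zero_apply]
    exact (mem_awayKer_top_iff (v : HeightOneSpectrum (𝓞 K)) c).mp
      (mem_awayKer_of_mem_selmerAcBase h (hTp v v.2) (hTS v v.2))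
  · intro h
    have h0' : ∀ m : W.geomPrimaryTorsion p,
        (∀ y ∈ decomp 𝔭 ⊓ κ.kerSubgroup, y • m = m) → m = 0 := fun m hm ↦
      AddSubgroup.mem_bot.mp (h0 ▸ (fun y ↦ hm y y.2 :
        m ∈ FixedPoints.addSubgroup ↥(decomp 𝔭 ⊓ κ.kerSubgroup) (W.geomPrimaryTorsion p)))
    refine (mem_selmerAcBase_iff_away_inf κ 𝔭 S (W.continuous_smul_geomPrimaryTorsion p) h0'
      hcSel).mpr ⟨fun v hv hvS ↦ ?_, fun w ↦ ?_⟩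
    · by_cases hvT : v ∈ T
      · have hv0 := congr_fun h ⟨v, hvT⟩
        rw [locAtFinset_apply, Pi.zero_apply] at hv0
        exact (mem_awayKer_top_iff v c).mpr hv0
      · exact hS c hcSel v hv hvS hvT
    · exact infConditions_descend_of_isTotallyComplex W p κ 𝔭 S c hcSel w

/-- **`res : A ↠ Sel_𝔭^Σ(K_∞, E[p^∞])^γ`** (Lemma 3.2, `coker h_0 = 0`, tree-proved): every
`γ`-invariant class is the restriction of a class of `A`. [cite: GreenbergLNM1716, §3 Lemma 3.2 (p. 86)] -/
theorem exists_mem_selmerAcPreimage_resOfLe_eq {γ : absoluteGaloisGroup K} (hγ : κ.IsTopGenerator γ)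
    (x : IwasawaDual.endInvariants (conjSelmerAc W p κ 𝔭 S γ - 1)) :
    ∃ c ∈ selmerAcPreimage W p κ 𝔭 S,
      W.resOfLe p (le_top : κ.kerSubgroup ≤ ⊤) c =
        ((x : selmerAc W p κ 𝔭 S) : W.subgroupH1 p κ.kerSubgroup) := by
  have hprim : ∀ m : W.geomPrimaryTorsion p, ∃ k : ℕ, p ^ k • m = 0 := fun m ↦ by
    obtain ⟨k, hk⟩ := m.2
    exact ⟨k, Subtype.ext (by rw [AddSubgroupClass.coe_nsmul, hk, ZeroMemClass.coe_zero])⟩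
  have hx : W.conjH1 p κ.kerSubgroup γ ((x : selmerAc W p κ 𝔭 S) : W.subgroupH1 p κ.kerSubgroup) =
      ((x : selmerAc W p κ 𝔭 S) : W.subgroupH1 p κ.kerSubgroup) := by
    have h := (IwasawaDual.mem_endInvariants_iff _ _).mp x.2
    rw [IwasawaDual.End_sub_apply, AddMonoid.End.one_apply, sub_eq_zero] at h
    exact congrArg (fun y : selmerAc W p κ 𝔭 S ↦ (y : W.subgroupH1 p κ.kerSubgroup)) h
  obtain ⟨c, hc⟩ := exists_resOfLe_top_eq_of_conj_eq κ hγ (W.continuous_smul_geomPrimaryTorsion p)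
    hprim _ hx
  exact ⟨c, (mem_selmerAcPreimage_iff c).mpr (hc ▸ (x : selmerAc W p κ 𝔭 S).2), hc⟩

end Preimage

section Count

variable {K : Type} [Field K] [NumberField K]
variable {W : WeierstrassCurve K} {p : ℕ} [Fact p.Prime] {κ : ZpExtension K p}
  {𝔭 : HeightOneSpectrum (𝓞 K)} {S : Set (HeightOneSpectrum (𝓞 K))}

/-- **The counting snake lemma (Greenberg §3 / JSW §3.3; the direction route p2 consumes).** For
`E` over a totally complex `K`, `κ` with topological generator `γ`, `𝔭`, `Σ`, a finite set `T` of
finite places `v ∤ p`, `v ∉ Σ`: if `E(K̄)[p^∞]^{D_𝔭 ⊓ ker κ} = 0`, the away conditions descend at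
every finite `v ∤ p` outside `Σ ∪ T`, and `Sel_𝔭^Σ(K, E[p^∞])` and the `ker r_v` (`v ∈ T`) are
finite, then `Sel_𝔭^Σ(K_∞, E[p^∞])^γ` is finite and `#Sel^γ ≤ #Sel_𝔭^Σ(K, E[p^∞]) · ∏_{v∈T} #ker r_v`
(`res : A ↠ Sel^γ`; `ψ|_A` has kernel `Sel_𝔭^Σ(K)` and image in `∏ ker r_v`). Lemma 3.1 is not used.
[cite: GreenbergLNM1716, §3 pp. 85–86 (snake lemma) and p. 90 (Lemma 3.5, Thm. 1.2)]
[cite: JetchevSkinnerWan2017, §3.3 and Thm. 3.3.1 (control; shape only)] -/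
theorem finite_endInvariants_and_natCard_le_of_localKer [IsTotallyComplex K]
    {γ : absoluteGaloisGroup K} (hγ : κ.IsTopGenerator γ)
    (h0 : FixedPoints.addSubgroup ↥(decomp 𝔭 ⊓ κ.kerSubgroup) (W.geomPrimaryTorsion p) = ⊥)
    (T : Finset (HeightOneSpectrum (𝓞 K)))
    (hTp : ∀ v ∈ T, ((p : ℕ) : 𝓞 K) ∉ v.asIdeal) (hTS : ∀ v ∈ T, v ∉ S)
    (hS : ∀ c : W.subgroupH1 p (⊤ : Subgroup (absoluteGaloisGroup K)),
      W.resOfLe p (le_top : κ.kerSubgroup ≤ ⊤) c ∈ selmerAc W p κ 𝔭 S →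
        ∀ v : HeightOneSpectrum (𝓞 K), ((p : ℕ) : 𝓞 K) ∉ v.asIdeal → v ∉ S → v ∉ T →
          c ∈ awayKer ⊤ (W.geomPrimaryTorsion p) v)
    [Finite (selmerAcBase W p 𝔭 S)]
    (hfin : ∀ v ∈ T, Finite (localKer κ.kerSubgroup (W.geomPrimaryTorsion p) v)) :
    Finite (IwasawaDual.endInvariants (conjSelmerAc W p κ 𝔭 S γ - 1)) ∧
      Nat.card (IwasawaDual.endInvariants (conjSelmerAc W p κ 𝔭 S γ - 1)) ≤
        Nat.card (selmerAcBase W p 𝔭 S) *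
          ∏ v ∈ T, Nat.card (localKer κ.kerSubgroup (W.geomPrimaryTorsion p) v) := by
  set A := selmerAcPreimage W p κ 𝔭 S
  -- the localisation restricted to `A`; (1) its image lies in `∏ ker r_v`
  set ψ : A →+ Π v : T, subgroupH1 ((⊤ : Subgroup (absoluteGaloisGroup K)) ⊓
      decomp (v : HeightOneSpectrum (𝓞 K))) (W.geomPrimaryTorsion p) :=
    (locAtFinset W p T).comp A.subtype
  have hrange : ∀ (a : A) (v : T), ψ a v ∈ localKer κ.kerSubgroup (W.geomPrimaryTorsion p) v :=
    fun a v ↦ resOfLe_mem_localKer_of_mem_selmerAcPreimage a.2 (hTp v v.2) (hTS v v.2)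
  -- (2) the kernel is `Sel_𝔭^Σ(K, E[p^∞])`
  have hker : ∀ a : A, a ∈ ψ.ker ↔ (a : W.subgroupH1 p ⊤) ∈ selmerAcBase W p 𝔭 S := by
    intro a
    rw [AddMonoidHom.mem_ker, mem_selmerAcBase_iff_locAtFinset_eq_zero h0 hTp hTS hS a.2]
    rfl
  -- (3) finiteness and count of `im ψ`
  haveI hfinT : ∀ v : T, Finite (localKer κ.kerSubgroup (W.geomPrimaryTorsion p)
      (v : HeightOneSpectrum (𝓞 K))) := fun v ↦ hfin v v.2
  let e : ψ.range → Π v : T, localKer κ.kerSubgroup (W.geomPrimaryTorsion p)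
      (v : HeightOneSpectrum (𝓞 K)) :=
    fun y ↦ fun v ↦ ⟨y.1 v, by
      obtain ⟨a, ha⟩ := y.2
      rw [← ha]
      exact hrange a v⟩
  have he : Function.Injective e := by
    intro y₁ y₂ h
    apply Subtype.ext
    funext v
    simpa [e] using congrArg Subtype.val (congr_fun h v)
  haveI : Finite ψ.range := Finite.of_injective e he
  have hcard_range : Nat.card ψ.range ≤
      ∏ v ∈ T, Nat.card (localKer κ.kerSubgroup (W.geomPrimaryTorsion p) v) := by
    calc Nat.card ψ.range
        ≤ Nat.card (Π v : T, localKer κ.kerSubgroup (W.geomPrimaryTorsion p)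
            (v : HeightOneSpectrum (𝓞 K))) := Nat.card_le_card_of_injective e he
      _ = ∏ v : T, Nat.card (localKer κ.kerSubgroup (W.geomPrimaryTorsion p)
            (v : HeightOneSpectrum (𝓞 K))) := Nat.card_pi
      _ = ∏ v ∈ T, Nat.card (localKer κ.kerSubgroup (W.geomPrimaryTorsion p) v) :=
          Finset.prod_coe_sort T fun v ↦
            Nat.card (localKer κ.kerSubgroup (W.geomPrimaryTorsion p) v)
  -- (4) finiteness and count of `ker ψ`
  let f : ψ.ker → selmerAcBase W p 𝔭 S := fun a ↦ ⟨((a : A) : W.subgroupH1 p ⊤), (hker a).mp a.2⟩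
  have hf : Function.Injective f := by
    intro a₁ a₂ h
    apply Subtype.ext; apply Subtype.ext
    simpa [f] using congrArg (fun x : selmerAcBase W p 𝔭 S ↦ (x : W.subgroupH1 p ⊤)) h
  haveI : Finite ψ.ker := Finite.of_injective f hf
  have hcard_ker : Nat.card ψ.ker ≤ Nat.card (selmerAcBase W p 𝔭 S) :=
    Nat.card_le_card_of_injective f hf
  -- (5) `A` is finite and `#A ≤ #Sel(K) · ∏ #ker r_v`
  haveI : Finite (A ⧸ ψ.ker) :=
    Finite.of_equiv _ (QuotientAddGroup.quotientKerEquivRange ψ).toEquiv.symm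
  haveI : Finite A :=
    Finite.of_equiv _ (AddSubgroup.addGroupEquivQuotientProdAddSubgroup (s := ψ.ker)).symm
  have hcardA : Nat.card A ≤ Nat.card (selmerAcBase W p 𝔭 S) *
      ∏ v ∈ T, Nat.card (localKer κ.kerSubgroup (W.geomPrimaryTorsion p) v) := by
    rw [AddSubgroup.card_eq_card_quotient_mul_card_addSubgroup ψ.ker,
      Nat.card_congr (QuotientAddGroup.quotientKerEquivRange ψ).toEquiv, mul_comm]
    exact Nat.mul_le_mul hcard_ker hcard_range
  -- (6) `res : A ↠ Sel^γ`
  let g : A → IwasawaDual.endInvariants (conjSelmerAc W p κ 𝔭 S γ - 1) := fun a ↦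
    ⟨⟨W.resOfLe p (le_top : κ.kerSubgroup ≤ ⊤) (a : W.subgroupH1 p ⊤),
        (mem_selmerAcPreimage_iff _).mp a.2⟩, by
      rw [IwasawaDual.mem_endInvariants_iff, IwasawaDual.End_sub_apply, AddMonoid.End.one_apply,
        sub_eq_zero]
      exact Subtype.ext (conjH1_resOfLe_top γ (a : W.subgroupH1 p ⊤))⟩
  have hg : Function.Surjective g := by
    intro x
    obtain ⟨c, hcA, hc⟩ := exists_mem_selmerAcPreimage_resOfLe_eq hγ x
    exact ⟨⟨c, hcA⟩, Subtype.ext (Subtype.ext hc)⟩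
  exact ⟨Finite.of_surjective g hg, (Nat.card_le_card_of_surjective g hg).trans hcardA⟩

/-- **Counting form with `p`-power bounds**: `#Sel_𝔭^Σ(K, E[p^∞]) ≤ p^a` and `#ker r_v ≤ p^{b v}`
(`v ∈ T`) give `#Sel_𝔭^Σ(K_∞, E[p^∞])^γ ≤ p^{a + ∑_{v∈T} b v}`. [cite: GreenbergLNM1716, §3 p. 90] -/
theorem natCard_endInvariants_le_pow_of_localKer [IsTotallyComplex K]
    {γ : absoluteGaloisGroup K} (hγ : κ.IsTopGenerator γ)
    (h0 : FixedPoints.addSubgroup ↥(decomp 𝔭 ⊓ κ.kerSubgroup) (W.geomPrimaryTorsion p) = ⊥)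
    (T : Finset (HeightOneSpectrum (𝓞 K)))
    (hTp : ∀ v ∈ T, ((p : ℕ) : 𝓞 K) ∉ v.asIdeal) (hTS : ∀ v ∈ T, v ∉ S)
    (hS : ∀ c : W.subgroupH1 p (⊤ : Subgroup (absoluteGaloisGroup K)),
      W.resOfLe p (le_top : κ.kerSubgroup ≤ ⊤) c ∈ selmerAc W p κ 𝔭 S →
        ∀ v : HeightOneSpectrum (𝓞 K), ((p : ℕ) : 𝓞 K) ∉ v.asIdeal → v ∉ S → v ∉ T →
          c ∈ awayKer ⊤ (W.geomPrimaryTorsion p) v)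
    [Finite (selmerAcBase W p 𝔭 S)]
    (hfin : ∀ v ∈ T, Finite (localKer κ.kerSubgroup (W.geomPrimaryTorsion p) v))
    {a : ℕ} (ha : Nat.card (selmerAcBase W p 𝔭 S) ≤ p ^ a) {b : HeightOneSpectrum (𝓞 K) → ℕ}
    (hb : ∀ v ∈ T, Nat.card (localKer κ.kerSubgroup (W.geomPrimaryTorsion p) v) ≤ p ^ b v) :
    Finite (IwasawaDual.endInvariants (conjSelmerAc W p κ 𝔭 S γ - 1)) ∧
      Nat.card (IwasawaDual.endInvariants (conjSelmerAc W p κ 𝔭 S γ - 1)) ≤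
        p ^ (a + ∑ v ∈ T, b v) := by
  obtain ⟨hfinγ, hle⟩ :=
    finite_endInvariants_and_natCard_le_of_localKer hγ h0 T hTp hTS hS hfin
  refine ⟨hfinγ, hle.trans ?_⟩
  rw [pow_add, ← Finset.prod_pow_eq_pow_sum]
  exact Nat.mul_le_mul ha (Finset.prod_le_prod' fun v hv ↦ hb v hv)

end Count

end Summit.BirchSwinnertonDyer.Rank1Residual.X11b.AcSelmer

namespace Summit.BirchSwinnertonDyer.Rank1Residual.X11b

/-! ## Route p2: (CTL≤)ᵗ at a datum from the two remaining inputs -/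
section RouteP2

open AcSelmer WeierstrassCurve Literature.NumberTheory.EllipticCurves.Rank1Residual
  Literature.NumberTheory.QuadraticFields.Quadratic

variable {W : WeierstrassCurve ℚ} [W.IsElliptic] [W.IsGloballyMinimal] {K : Type} [Field K]
  [NumberField K] {p : ℕ} [Fact p.Prime] {κ : ZpExtension K p} {𝔭 : HeightOneSpectrum (𝓞 K)}
  {γ : Field.absoluteGaloisGroup K} [Fact (κ.IsTopGenerator γ)] {ι : K →+* ℚ_[p]}

/-- **(CTL≤)ᵗ — route p2's algebraic input at a datum — from exactly two remaining inputs.** For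
`E/ℚ` over a totally complex `K` (every Heegner field), `κ` with topological generator `γ`, `𝔭` with
`E(K̄)[p^∞]^{D_𝔭 ⊓ ker κ} = 0` (⇐ (iv), sibling `AnticyclotomicLocalTorsionDescent`), `T` finite
outside which the away conditions descend (Lemma 3.3 at good `v`; `AnticyclotomicSplitPlaces`):
`ControlUpperOnTreeAt p κ 𝔭 γ ι P` (`Σ = ∅`) follows from (c) `#ker r_v ≤ p^{b v}` on `T`
[Lemma 3.3 at bad `v ∤ p`: `c_v^{(p)}`] and (d) `#Sel_𝔭(K, E[p^∞]) ≤ p^a` [JSW Prop. 3.2.1 /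
Cas18 (3.2.1) + the local index at `𝔭`; reciprocity half of Poitou–Tate], provided
`a + ∑_{v∈T} b v ≤ ord_p #Ш(E/K)[p^∞] + 2((ord_p log_ω P − 1) − ord_p[E(K):ℤP]) + ord_p ∏_{w∣N⁺} c_w`
(the exponent of Cas18 Thm. 2.3). (c), (d) are hypotheses — the only parts of (CTL≤)ᵗ that are not
tree theorems. CONDITIONAL; nothing booked. [cite: Castella2018, Thm. 2.3 and its proof (arXiv:1704.06608 pp. 5–6)]
[cite: GreenbergLNM1716, §3 Lemma 3.3 (p. 87), p. 90] [cite: JetchevSkinnerWan2017, Prop. 3.2.1, §3.3 (shape only)] -/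
theorem controlUpperOnTreeAt_of_localKer_bounds [IsTotallyComplex K]
    (h0 : FixedPoints.addSubgroup ↥(decomp 𝔭 ⊓ κ.kerSubgroup)
      ((W.baseChange K).geomPrimaryTorsion p) = ⊥)
    (T : Finset (HeightOneSpectrum (𝓞 K))) (hTp : ∀ v ∈ T, ((p : ℕ) : 𝓞 K) ∉ v.asIdeal)
    (hS : ∀ c : (W.baseChange K).subgroupH1 p (⊤ : Subgroup (Field.absoluteGaloisGroup K)),
      (W.baseChange K).resOfLe p (le_top : κ.kerSubgroup ≤ ⊤) c ∈
          selmerAc (W.baseChange K) p κ 𝔭 ∅ →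
        ∀ v : HeightOneSpectrum (𝓞 K), ((p : ℕ) : 𝓞 K) ∉ v.asIdeal → v ∉ (∅ : Set _) → v ∉ T →
          c ∈ awayKer ⊤ ((W.baseChange K).geomPrimaryTorsion p) v)
    [Finite (selmerAcBase (W.baseChange K) p 𝔭 ∅)]
    (hfin : ∀ v ∈ T, Finite (localKer κ.kerSubgroup ((W.baseChange K).geomPrimaryTorsion p) v))
    {a : ℕ} (ha : Nat.card (selmerAcBase (W.baseChange K) p 𝔭 ∅) ≤ p ^ a)
    {b : HeightOneSpectrum (𝓞 K) → ℕ}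
    (hb : ∀ v ∈ T,
      Nat.card (localKer κ.kerSubgroup ((W.baseChange K).geomPrimaryTorsion p) v) ≤ p ^ b v)
    {P : (W.baseChange K).toAffine.Point}
    (hm : ((a + ∑ v ∈ T, b v : ℕ) : ℤ) ≤ (padicValNat p
        (Nat.card (AddCommGroup.primaryComponent (W.baseChange K).sha p)) : ℤ) +
      2 * ((padicLogOrd W p ι P - 1) - (padicValNat p (AddSubgroup.zmultiples P).index : ℤ)) +
        padicValNat p (tamagawaProductSplit W K)) :
    ControlUpperOnTreeAt p κ 𝔭 γ ι P := by
  obtain ⟨hfinγ, hle⟩ := natCard_endInvariants_le_pow_of_localKer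
    (W := W.baseChange K) (S := (∅ : Set (HeightOneSpectrum (𝓞 K))))
    (Fact.out : κ.IsTopGenerator γ) h0 T hTp (fun v _ ↦ Set.notMem_empty v) hS hfin ha hb
  exact controlUpperOnTreeAt_of_natCard_invariants_le hfinγ hle hm

end RouteP2

end Summit.BirchSwinnertonDyer.Rank1Residual.X11b

end
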